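import Literature.AlgebraicGeometry.HodgeTheory.AnalytificationCartierDivisor
import Literature.AlgebraicGeometry.HodgeTheory.ChernCharacterClass
import Literature.AlgebraicGeometry.HodgeTheory.HolomorphicBundleChernCharacterHyperplane
import Literature.AlgebraicGeometry.HodgeTheory.LefschetzOneOneChernWeilProofs
import Literature.Geometry.Kaehler.HolomorphicLineBundleMetric
import HarnessLib

/-!
# The first Chern class of `𝒪_X(D)^an` is an algebraic class (Voisin I, Thm. 11.33: `c₁` vanishes off `D`)

Family `hodge`, layer `Literature/AlgebraicGeometry/HodgeTheory`. For a Cartier divisor `D` on a smooth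
projective `X/ℂ` the holomorphic line bundle `𝒪_X(D)^an` on a Hodge model `A` (the cocycle
`cartierDivisorCocycle`, file `AnalytificationCartierDivisor`) has a first Chern class
`c₁(𝒪_X(D)^an) = A.chernCharacter (cartierDivisorCocycle …) 1 ∈ H²(X(ℂ); ℂ)` (`ChernCharacterClass`,
Chern–Weil I–II proved in the tree). Voisin I, proof of Thm. 11.33 (p. 280): "the Chern class `c₁(Lᵢ)`
vanishes on `X − Dᵢ`, since `Lᵢ` is trivial on `X − Dᵢ`" — so `c₁(Lᵢ)` is supported on the divisor.
This file PROVES that statement on the tree's real carriers: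

* `cartierDivisorLineBundle hφ D` — `𝒪_X(D)^an` as a `HolomorphicLineBundle` (Voisin's frame
  convention `σ_i = g_ij σ_j`, `g_ij = f_j/f_i` read on `M`), with
  `cartierDivisorLineBundle_toSmoothCocycle : (…).toSmoothCocycle = cartierDivisorCocycle hφ D` (rfl) and
  `cartierDivisorLineBundle_isTrivialOn` — **`𝒪_X(D)^an` is holomorphically trivial over `φ⁻¹(X_s(ℂ))`**
  for every global section `s` of `𝒪_X(D)` (its coordinates `s_i = f_i s`, `AnalytificationCartierDivisor`);
* `CartierDivisor.nonvanishing_nonempty` — for a non-zero section `s`, `X_s ≠ ∅` (a non-zero rational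
  function is a unit on a non-empty open set, Mathlib's `exists_isUnit_germ_eq`, and `X` is irreducible);
* `chernCharacter_cartierDivisorCocycle_mem_algebraicClasses` — **`c₁(𝒪_X(D)^an) ∈ algebraicClasses X 1`
  for every Cartier divisor `D` with a non-zero global section** (e.g. `D` effective, `s = 1`:
  `chernCharacter_cartierDivisorCocycle_mem_algebraicClasses_of_isSection_one`): choose a Hermitian metric
  (`HolomorphicLineBundle.nonempty_hermitianMetric`) and its global Chern form `θ`
  (`HermitianMetric.exists_isChernForm`), which computes `c₁` (`HodgeModel.pullback_chernCharacter` with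
  `HermitianMetric.isChernCharacterForm_of_isChernForm`) and is EXACT over `φ⁻¹(X_s(ℂ))`
  (`chernForm_exact_of_isTrivialOn_holds`); hence the class dies on `(X ∖ Z)(ℂ)`, `Z = X ∖ X_s` a proper
  Zariski-closed subset, of codimension `≥ 1` (`HodgeModel.restrictCompl_eq_zero_of_map_val_eq_zero`,
  `one_le_coheight_of_mem_of_isClosed_of_ne_univ`), i.e. lies in `N¹ H²(X(ℂ); ℂ) = algebraicClasses X 1`.

This is the "algebraic line bundles have algebraic Chern classes" half of Lefschetz's theorem on
`(1,1)`-classes in the divisor form of Voisin I, Thm. 11.33 / Cor. 11.34; the other half (every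
holomorphic line bundle on `X^an` is an `𝒪_X(D)^an`, GAGA) is not in the tree. Everything is proved;
no named facts.

## References

* C. Voisin, *Hodge Theory and Complex Algebraic Geometry I* (2002), §11.1.2, Thm. 11.33 (proof, p. 280),
  Thm. 7.10. [VoisinHodgeI2002]
* J.-P. Serre, *GAGA* (1956), §2 n° 6, §3 n° 9. [SerreGAGA1956]
-/

noncomputable section

open scoped Manifold ContDiff
open CategoryTheory AlgebraicGeometry TopologicalSpace
open Literature.AlgebraicGeometry.Motives
open Literature.AlgebraicGeometry.Motives.RatFn
open Literature.AlgebraicGeometry.Motives.AlgPoints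
open Literature.NumberTheory.Transcendental
open Literature.Geometry.Kaehler

namespace Literature.AlgebraicGeometry.HodgeTheory

/-! ### `𝒪_X(D)^an` as a holomorphic line cocycle in Voisin's convention -/

section LineBundle

variable {X : SchemeOver ℂ} [IsIntegral X.left] {n : ℕ}
  {E : Type*} [NormedAddCommGroup E] [NormedSpace ℂ E] [FiniteDimensional ℂ E]
  {M : Type*} [TopologicalSpace M] [ChartedSpace E M]
  {φ : M → ComplexPoints X} (hφ : IsAnalytification E X n φ) (D : CartierDivisor X.left)

/-- **`𝒪_X(D)^an` as a `HolomorphicLineBundle`** on the analytification `φ : M → X(ℂ)`: trivialising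
opens `φ⁻¹(U_i(ℂ))`, and in Voisin's frame convention `σ_i = g_ij σ_j` the transition function
`g_ij = (f_j/f_i)(φ m)` (the Čech cocycle `f_i/f_j` of `𝒪_X(D)`, Görtz–Wedhorn I (11.9), read in the
coordinate convention `ξ_i = (f_i/f_j) ξ_j`, is Kobayashi's `s_j = s_i g'_ij`; see
`cartierDivisorLineBundle_toSmoothCocycle`). Holomorphic since regular functions are holomorphic on an
analytification (Serre, GAGA §2 n° 6). [cite: SerreGAGA1956, §2 n°6 and §3 n°9] -/
def cartierDivisorLineBundle : HolomorphicLineBundle D.ι E M where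
  baseSet i := φ ⁻¹' {P | P.pt ∈ D.U i}
  isOpen_baseSet i := hφ.isOpen_preimage (D.U i)
  exists_mem_baseSet m := D.covers (φ m).pt
  coordChange i j m := evalOrZero (D.U j ⊓ D.U i) (D.transFun j i) (φ m)
  mdifferentiableOn_coordChange i j :=
    (IsAnalytification.mdifferentiableOn_evalOrZero_opens_holds hφ (D.U j ⊓ D.U i) (D.transFun j i)).mono
      fun _ hm ↦ ⟨hm.2, hm.1⟩
  coordChange_ne_zero i j m hm :=
    left_ne_zero_of_mul_eq_one (D.evalOrZero_transFun_mul_symm (P := φ m) hm.2 hm.1)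
  coordChange_comp i j k m hm := by
    rw [mul_comm]
    exact D.evalOrZero_transFun_mul hm.2 hm.1.2 hm.1.1

/-- The trivialising sets of `cartierDivisorLineBundle` (definitional). [folklore] -/
@[simp]
theorem cartierDivisorLineBundle_baseSet (i : D.ι) :
    (cartierDivisorLineBundle hφ D).baseSet i = φ ⁻¹' {P | P.pt ∈ D.U i} :=
  rfl

/-- **The rank-one smooth cocycle of `cartierDivisorLineBundle` is `cartierDivisorCocycle`** (the two
conventions `σ_i = g_ij σ_j` / `s_j = s_i g'_ij` are matched by `HolomorphicLineBundle.toSmoothCocycle`).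
[cite: SerreGAGA1956, §3 n°9] -/
theorem cartierDivisorLineBundle_toSmoothCocycle [IsManifold 𝓘(ℂ, E) ω M] [IsManifold 𝓘(ℝ, E) ∞ M] :
    (cartierDivisorLineBundle hφ D).toSmoothCocycle = cartierDivisorCocycle hφ D :=
  rfl

variable {D} in
/-- **`𝒪_X(D)^an` is holomorphically trivial over `φ⁻¹(X_s(ℂ))`** for every global section `s` of
`𝒪_X(D)`: the coordinates `s_i = f_i s` are holomorphic, non-vanishing on `φ⁻¹((U_i ∩ X_s)(ℂ))` and
transform by `s_j = (f_j/f_i) s_i` (`AnalytificationCartierDivisor`). Voisin I, proof of Thm. 11.33: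
"`L_i` is trivial on `X − D_i`". [cite: VoisinHodgeI2002, Thm. 11.33 (proof)] -/
theorem cartierDivisorLineBundle_isTrivialOn {s : X.left.functionField} (hs : D.IsSection s) :
    (cartierDivisorLineBundle hφ D).IsTrivialOn (φ ⁻¹' {P | P.pt ∈ D.nonvanishing s}) :=
  ⟨fun i ↦ D.sectionCoord φ hs i, fun i ↦ (mdifferentiableOn_sectionCoord hφ hs i).mono Set.inter_subset_left,
    fun _ _ hm ↦ sectionCoord_ne_zero hs hm.1 hm.2, fun _ _ _ hm ↦ sectionCoord_eq_mul hs hm.1.1 hm.1.2⟩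

end LineBundle

/-! ### Non-zero sections have non-empty non-vanishing loci -/

/-- **A non-zero global section of `𝒪_X(D)` does not vanish identically**: `X_s ≠ ∅`. The rational
function `f_i s ≠ 0` is the germ of a unit section over some non-empty open `U` (Mathlib's
`exists_isUnit_germ_eq`), hence a unit of `𝒪_{X,y}` at every `y ∈ U`; and `U` meets the non-empty
open `U_i`, `X` being irreducible. [folklore] -/
theorem _root_.Literature.AlgebraicGeometry.Motives.CartierDivisor.nonvanishing_nonempty
    {Y : Scheme} [IsIntegral Y] (D : CartierDivisor Y) {s : Y.functionField} (hs0 : s ≠ 0) :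
    (D.nonvanishing s).Nonempty := by
  obtain ⟨x₀⟩ := (inferInstance : Nonempty Y)
  obtain ⟨i, hi⟩ := D.covers x₀
  have hf : D.f i * s ≠ 0 := mul_ne_zero (D.f_ne_zero i) hs0
  obtain ⟨U, -, f', ⟨⟨u₀, hu₀⟩⟩, hf'f, hunit⟩ := exists_isUnit_germ_eq Y (D.f i * s) hf
  haveI : Nonempty U := ⟨⟨u₀, hu₀⟩⟩
  obtain ⟨y, hyU, hyi⟩ := nonempty_preirreducible_inter U.isOpen (D.U i).isOpen ⟨u₀, hu₀⟩ ⟨x₀, hi⟩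
  refine ⟨y, i, hyi, ?_⟩
  have hunit_y : IsUnitAt y (toFunctionField y (Y.presheaf.germ U y hyU f')) :=
    (isUnitAt_germ_iff hyU f').2 ((Y.mem_basicOpen f' y hyU).2 (hunit.map _))
  rwa [toFunctionField_germ hyU f', show Y.presheaf.germ U (genericPoint Y) _ f' = D.f i * s from hf'f]
    at hunit_y

/-! ### `c₁(𝒪_X(D)^an)` is supported on the divisor -/

section ChernClass

variable {n : ℕ} {X : SchemeOver ℂ} [IsIntegral X.left]

/-- **`c₁(𝒪_X(D)^an)` is an algebraic class** (Voisin I, proof of Thm. 11.33: "the Chern class `c₁(Lᵢ)`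
vanishes on `X − Dᵢ`, since `Lᵢ` is trivial on `X − Dᵢ`"): for an integral `X/ℂ` with a Hodge model
`A` (e.g. `X` smooth projective) and a Cartier divisor `D` with a NON-ZERO global section `s`, the first
Chern class
`c₁(𝒪_X(D)^an) = A.chernCharacter (cartierDivisorCocycle A.isAnalytification D) 1` lies in
`algebraicClasses X 1 = N¹ H²(X(ℂ); ℂ)` — it dies on `(X ∖ Z)(ℂ)` for the proper Zariski-closed
`Z = X ∖ X_s`, because a Chern form computing it (`HermitianMetric.exists_isChernForm`, Chern–Weil II)
is exact where the bundle is trivial (`chernForm_exact_of_isTrivialOn_holds`).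
[cite: VoisinHodgeI2002, Thm. 11.33 (proof) and Thm. 7.10] -/
theorem chernCharacter_cartierDivisorCocycle_mem_algebraicClasses
    (A : HodgeModel n X) (D : CartierDivisor X.left) {s : X.left.functionField} (hs : D.IsSection s)
    (hs0 : s ≠ 0) :
    A.chernCharacter (cartierDivisorCocycle A.isAnalytification D) 1 ∈ algebraicClasses X 1 := by
  set L := cartierDivisorLineBundle A.isAnalytification D with hL
  obtain ⟨h⟩ := L.nonempty_hermitianMetric
  obtain ⟨θ, hθs, hθc, hθ⟩ := h.exists_isChernForm
  -- `c₁(𝒪_X(D)^an)` is computed by the Chern form `θ`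
  have hpull : A.pullback (2 * 1) (A.chernCharacter (cartierDivisorCocycle A.isAnalytification D) 1) =
      A.deRham A.carrier (2 * 1)
        (complexDeRhamCohomology.mk A.model A.carrier (2 * 1) ⟨θ, mem_cclosedSmoothForms hθs hθc⟩) := by
    rw [← cartierDivisorLineBundle_toSmoothCocycle A.isAnalytification D]
    exact A.pullback_chernCharacter L.toSmoothCocycle 1 h.chernConnection hθs hθc
      (h.isChernCharacterForm_of_isChernForm hθ)
  -- `θ` is exact over `W = φ⁻¹(X_s(ℂ))`, where the bundle is trivial
  let W : Opens A.carrier :=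
    ⟨A.toComplexPoints ⁻¹' {P | P.pt ∈ D.nonvanishing s}, isOpen_preimage_nonvanishing A.isAnalytification D s⟩
  obtain ⟨η, hη, hdη⟩ := chernForm_exact_of_isTrivialOn_holds L h θ hθs hθ W
    (cartierDivisorLineBundle_isTrivialOn A.isAnalytification hs)
  have hexact : θ.pullback 𝓘(ℝ, A.model) (Subtype.val : W → A.carrier) ∈ cexactSmoothForms A.model W 2 := by
    rw [← hdη]
    exact Submodule.subset_span ⟨η, (mem_csmoothForms_iff η).2 hη, rfl⟩
  have hmap : complexDeRhamCohomology.map A.model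
      (fun z ↦ contMDiff_subtype_val z : ContMDiff 𝓘(ℝ, A.model) 𝓘(ℝ, A.model) ∞ (Subtype.val : W → A.carrier))
      (2 * 1) (complexDeRhamCohomology.mk A.model A.carrier (2 * 1) ⟨θ, mem_cclosedSmoothForms hθs hθc⟩) = 0 := by
    rw [complexDeRhamCohomology.map_mk, ← (complexDeRhamCohomology.mk A.model W 2).map_zero,
      complexDeRhamCohomology.mk_eq_mk_iff, Submodule.coe_zero, sub_zero]
    exact hexact
  -- the proper Zariski-closed subset `Z = X ∖ X_s`
  set Z : Set X.left := (D.nonvanishing s)ᶜ with hZ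
  have hZc : IsClosed Z := (D.isOpen_nonvanishing s).isClosed_compl
  have hZne : Z ≠ Set.univ := fun hu ↦ by
    obtain ⟨y, hy⟩ := D.nonvanishing_nonempty hs0
    exact (hu ▸ Set.mem_univ y : y ∈ Z) hy
  have hcodim : ∀ z ∈ Z, ((1 : ℕ) : ℕ∞) ≤ Order.coheight z := fun z hz ↦
    one_le_coheight_of_mem_of_isClosed_of_ne_univ hZc hZne hz
  have hUZ : ∀ m, m ∈ W ↔ (A.toComplexPoints m).pt ∉ Z := fun m ↦ by
    rw [hZ, Set.mem_compl_iff, not_not]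
    rfl
  have hres : complexBetti.restrictCompl X Z (2 * 1)
      (A.chernCharacter (cartierDivisorCocycle A.isAnalytification D) 1) = 0 :=
    A.restrictCompl_eq_zero_of_map_val_eq_zero W hUZ _ (A.map_val_pullback_eq_zero_of_map_mk_eq_zero W _ hmap hpull)
  exact mem_supportedClasses_of_restrictCompl_eq_zero hZc hcodim hres

/-- **In particular for EFFECTIVE divisors** (`1 ∈ Γ(X, 𝒪_X(D))`, i.e. `D.IsSection 1`, Görtz–Wedhorn I
p. 377): `c₁(𝒪_X(D)^an) ∈ algebraicClasses X 1`. [cite: VoisinHodgeI2002, Thm. 11.33 (proof)] -/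
theorem chernCharacter_cartierDivisorCocycle_mem_algebraicClasses_of_isSection_one
    (A : HodgeModel n X) (D : CartierDivisor X.left) (hD : D.IsSection 1) :
    A.chernCharacter (cartierDivisorCocycle A.isAnalytification D) 1 ∈ algebraicClasses X 1 :=
  chernCharacter_cartierDivisorCocycle_mem_algebraicClasses A D hD one_ne_zero

end ChernClass

/-! ### Every Cartier divisor: `𝒪_X(D)^an` is trivial off the support, so `c₁` is algebraic -/

section OffSupport

variable {X : SchemeOver ℂ} [IsIntegral X.left] {n : ℕ}
  {E : Type*} [NormedAddCommGroup E] [NormedSpace ℂ E] [FiniteDimensional ℂ E]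
  {M : Type*} [TopologicalSpace M] [ChartedSpace E M]
  {φ : M → ComplexPoints X} (hφ : IsAnalytification E X n φ) (D : CartierDivisor X.left)

/-- The open `V_i = U_i ∩ X₁ ⊆ X` on which the local equation `f_i` is a UNIT (`X₁ = X ∖ Supp D`, the
non-vanishing locus of the rational section `1`; for `D` effective, `X ∖ D`). [cite: GortzWedhorn2020, Section (11.9)] -/
def _root_.Literature.AlgebraicGeometry.Motives.CartierDivisor.unitOpens (i : D.ι) : X.left.Opens :=
  D.U i ⊓ D.nonvanishingOpens 1

variable {D} in
/-- On `V_i` the local equation `f_i` is a unit. [folklore] -/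
theorem _root_.Literature.AlgebraicGeometry.Motives.CartierDivisor.isUnitAt_f_of_mem_unitOpens {i : D.ι}
    {x : X.left} (hx : x ∈ D.unitOpens i) : IsUnitAt x (D.f i) := by
  have h := (D.mem_nonvanishing_iff hx.1).1 hx.2
  rwa [mul_one] at h

variable {D} in
/-- `f_i` as a regular function on `V_i`. [folklore] -/
def _root_.Literature.AlgebraicGeometry.Motives.CartierDivisor.fSection {i : D.ι}
    (h : genericPoint X.left ∈ D.unitOpens i) : Γ(X.left, D.unitOpens i) :=
  sectionOf h (D.f i) fun _ hy ↦ (CartierDivisor.isUnitAt_f_of_mem_unitOpens hy).isRegularAt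

open scoped Classical in
variable (φ) in
/-- **The coordinate `f_i(φ m)` of the rational section `1` of `𝒪_X(D)` over `φ⁻¹(V_i(ℂ))`** (junk `0` if
`V_i = ∅`). [cite: GortzWedhorn2020, Section (11.9)] -/
def _root_.Literature.AlgebraicGeometry.Motives.CartierDivisor.unitCoord (i : D.ι) : M → ℂ := fun m ↦
  if h : genericPoint X.left ∈ D.unitOpens i then evalOrZero (D.unitOpens i) (D.fSection h) (φ m) else 0

variable {D}

omit [TopologicalSpace M] in
/-- On `φ⁻¹(V_i(ℂ))` the coordinate is the value of the regular function `f_i`. [folklore] -/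
theorem unitCoord_apply_of_mem {i : D.ι} {m : M} (hm : (φ m).pt ∈ D.unitOpens i) :
    D.unitCoord φ i m = evalOrZero (D.unitOpens i) (D.fSection (genericPoint_mem_of_mem hm)) (φ m) := by
  rw [CartierDivisor.unitCoord, dif_pos (genericPoint_mem_of_mem hm)]

include hφ in
/-- The coordinates `f_i(φ m)` are holomorphic on `φ⁻¹(V_i(ℂ))`. [cite: SerreGAGA1956, §2 n°6] -/
theorem mdifferentiableOn_unitCoord (i : D.ι) :
    MDifferentiableOn 𝓘(ℂ, E) 𝓘(ℂ, ℂ) (D.unitCoord φ i) (φ ⁻¹' {P | P.pt ∈ D.unitOpens i}) := by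
  by_cases h : genericPoint X.left ∈ D.unitOpens i
  · have heq : D.unitCoord φ i = fun m ↦ evalOrZero (D.unitOpens i) (D.fSection h) (φ m) := by
      funext m
      rw [CartierDivisor.unitCoord, dif_pos h]
    rw [heq]
    exact IsAnalytification.mdifferentiableOn_evalOrZero_opens_holds hφ (D.unitOpens i) _
  · intro m hm
    exact absurd (genericPoint_mem_of_mem hm) h

omit [TopologicalSpace M] in
/-- The coordinates do not vanish on `φ⁻¹(V_i(ℂ))` (`f_i` is a unit there). [folklore] -/
theorem unitCoord_ne_zero {i : D.ι} {m : M} (hm : (φ m).pt ∈ D.unitOpens i) : D.unitCoord φ i m ≠ 0 := by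
  rw [unitCoord_apply_of_mem hm, evalOrZero_of_mem _ hm]
  refine (pt_mem_basicOpen_iff (φ m) hm _).1 ?_
  rw [← isUnitAt_ofSection_iff hm, CartierDivisor.fSection, ofSection_sectionOf]
  exact CartierDivisor.isUnitAt_f_of_mem_unitOpens hm

omit [TopologicalSpace M] in
/-- **The transformation rule `f_j(φ m) = (f_j/f_i)(φ m) · f_i(φ m)`** on `φ⁻¹((V_i ∩ V_j)(ℂ))`.
[cite: GortzWedhorn2020, Section (11.9) and Rem. 11.16] -/
theorem unitCoord_eq_mul {i j : D.ι} {m : M} (hi : (φ m).pt ∈ D.unitOpens i) (hj : (φ m).pt ∈ D.unitOpens j) :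
    D.unitCoord φ j m = evalOrZero (D.U j ⊓ D.U i) (D.transFun j i) (φ m) * D.unitCoord φ i m := by
  have hW : (φ m).pt ∈ D.unitOpens i ⊓ D.unitOpens j := ⟨hi, hj⟩
  have hsec : X.left.presheaf.map (homOfLE (inf_le_right : D.unitOpens i ⊓ D.unitOpens j ≤ D.unitOpens j)).op
      (D.fSection (genericPoint_mem_of_mem hj)) =
      X.left.presheaf.map (homOfLE (le_inf (inf_le_right.trans inf_le_left) (inf_le_left.trans inf_le_left) :
          D.unitOpens i ⊓ D.unitOpens j ≤ D.U j ⊓ D.U i)).op (D.transFun j i) *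
        X.left.presheaf.map (homOfLE (inf_le_left : D.unitOpens i ⊓ D.unitOpens j ≤ D.unitOpens i)).op
          (D.fSection (genericPoint_mem_of_mem hi)) := by
    refine section_ext fun h ↦ ?_
    simp only [map_mul, ofSection_map, CartierDivisor.fSection, ofSection_sectionOf, CartierDivisor.ofSection_transFun]
    rw [div_mul_cancel₀ _ (D.f_ne_zero i)]
  have h := congrArg (fun σ ↦ evalOrZero (D.unitOpens i ⊓ D.unitOpens j) σ (φ m)) hsec
  simp only [evalOrZero_mul_apply] at h
  rw [evalOrZero_map_homOfLE _ _ hW, evalOrZero_map_homOfLE _ _ hW, evalOrZero_map_homOfLE _ _ hW] at h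
  rw [unitCoord_apply_of_mem hj, unitCoord_apply_of_mem hi]
  exact h

variable (D) in
/-- **`𝒪_X(D)^an` is holomorphically trivial over `φ⁻¹(X₁(ℂ))`, `X₁ = X ∖ Supp D`**, for EVERY Cartier
divisor `D` (the frame `f_i` over `φ⁻¹(V_i(ℂ))`). Voisin I, proof of Thm. 11.33: "`L_i` is trivial on
`X − D_i`". [cite: VoisinHodgeI2002, Thm. 11.33 (proof)] -/
theorem cartierDivisorLineBundle_isTrivialOn_nonvanishing_one :
    (cartierDivisorLineBundle hφ D).IsTrivialOn (φ ⁻¹' {P | P.pt ∈ D.nonvanishing 1}) :=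
  ⟨fun i ↦ D.unitCoord φ i, fun i ↦ (mdifferentiableOn_unitCoord hφ i).mono fun _ hm ↦ ⟨hm.1, hm.2⟩,
    fun _ _ hm ↦ unitCoord_ne_zero ⟨hm.1, hm.2⟩,
    fun _ _ _ hm ↦ unitCoord_eq_mul ⟨hm.1.1, hm.2⟩ ⟨hm.1.2, hm.2⟩⟩

end OffSupport

section ChernClassAll

variable {n : ℕ} {X : SchemeOver ℂ} [IsIntegral X.left]

/-- **`c₁(𝒪_X(D)^an)` is an algebraic class for EVERY Cartier divisor `D`** on an integral `X/ℂ` with a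
Hodge model `A` (Voisin I, proof of Thm. 11.33): as `chernCharacter_cartierDivisorCocycle_mem_algebraicClasses`,
with the trivialisation off the support `cartierDivisorLineBundle_isTrivialOn_nonvanishing_one` in place of
a global section (`X₁ = X ∖ Supp D` is non-empty: `CartierDivisor.nonvanishing_nonempty` with `s = 1`).
[cite: VoisinHodgeI2002, Thm. 11.33 (proof) and Thm. 7.10] -/
theorem chernCharacter_cartierDivisorCocycle_mem_algebraicClasses' (A : HodgeModel n X) (D : CartierDivisor X.left) :
    A.chernCharacter (cartierDivisorCocycle A.isAnalytification D) 1 ∈ algebraicClasses X 1 := by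
  set L := cartierDivisorLineBundle A.isAnalytification D with hL
  obtain ⟨h⟩ := L.nonempty_hermitianMetric
  obtain ⟨θ, hθs, hθc, hθ⟩ := h.exists_isChernForm
  have hpull : A.pullback (2 * 1) (A.chernCharacter (cartierDivisorCocycle A.isAnalytification D) 1) =
      A.deRham A.carrier (2 * 1)
        (complexDeRhamCohomology.mk A.model A.carrier (2 * 1) ⟨θ, mem_cclosedSmoothForms hθs hθc⟩) := by
    rw [← cartierDivisorLineBundle_toSmoothCocycle A.isAnalytification D]
    exact A.pullback_chernCharacter L.toSmoothCocycle 1 h.chernConnection hθs hθc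
      (h.isChernCharacterForm_of_isChernForm hθ)
  let W : Opens A.carrier :=
    ⟨A.toComplexPoints ⁻¹' {P | P.pt ∈ D.nonvanishing 1}, isOpen_preimage_nonvanishing A.isAnalytification D 1⟩
  obtain ⟨η, hη, hdη⟩ := chernForm_exact_of_isTrivialOn_holds L h θ hθs hθ W
    (cartierDivisorLineBundle_isTrivialOn_nonvanishing_one A.isAnalytification D)
  have hexact : θ.pullback 𝓘(ℝ, A.model) (Subtype.val : W → A.carrier) ∈ cexactSmoothForms A.model W 2 := by
    rw [← hdη]
    exact Submodule.subset_span ⟨η, (mem_csmoothForms_iff η).2 hη, rfl⟩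
  have hmap : complexDeRhamCohomology.map A.model
      (fun z ↦ contMDiff_subtype_val z : ContMDiff 𝓘(ℝ, A.model) 𝓘(ℝ, A.model) ∞ (Subtype.val : W → A.carrier))
      (2 * 1) (complexDeRhamCohomology.mk A.model A.carrier (2 * 1) ⟨θ, mem_cclosedSmoothForms hθs hθc⟩) = 0 := by
    rw [complexDeRhamCohomology.map_mk, ← (complexDeRhamCohomology.mk A.model W 2).map_zero,
      complexDeRhamCohomology.mk_eq_mk_iff, Submodule.coe_zero, sub_zero]
    exact hexact
  set Z : Set X.left := (D.nonvanishing 1)ᶜ with hZ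
  have hZc : IsClosed Z := (D.isOpen_nonvanishing 1).isClosed_compl
  have hZne : Z ≠ Set.univ := fun hu ↦ by
    obtain ⟨y, hy⟩ := D.nonvanishing_nonempty (one_ne_zero (α := X.left.functionField))
    exact (hu ▸ Set.mem_univ y : y ∈ Z) hy
  have hcodim : ∀ z ∈ Z, ((1 : ℕ) : ℕ∞) ≤ Order.coheight z := fun z hz ↦
    one_le_coheight_of_mem_of_isClosed_of_ne_univ hZc hZne hz
  have hUZ : ∀ m, m ∈ W ↔ (A.toComplexPoints m).pt ∉ Z := fun m ↦ by
    rw [hZ, Set.mem_compl_iff, not_not]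
    rfl
  have hres : complexBetti.restrictCompl X Z (2 * 1)
      (A.chernCharacter (cartierDivisorCocycle A.isAnalytification D) 1) = 0 :=
    A.restrictCompl_eq_zero_of_map_val_eq_zero W hUZ _ (A.map_val_pullback_eq_zero_of_map_mk_eq_zero W _ hmap hpull)
  exact mem_supportedClasses_of_restrictCompl_eq_zero hZc hcodim hres

end ChernClassAll

end Literature.AlgebraicGeometry.HodgeTheory
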